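import Summits.CriticalPhenomena.CardyFormulaZ2.Theorems.CardyComplexConeParafermionToSLESixFamiliesFlipDefs
import Summits.CriticalPhenomena.CardyFormulaZ2.Theorems.CardyComplexConeEdgePrecompactVertexRelationOnceTwice
import Literature.Probability.LatticeModels.MedialWindingBridge
import HarnessLib

/-!
# Return law, file 2: the line's visit vocabulary along the cut orbit (dictionary)
(line `flip-involution-return-law` of crux `CardyComplexCone.ParafermionToSLESixFamilies`, stmt-CriticalPhenomena-11389;
second helper file of the stub `stub_returnLaw`)

The vocabulary of `…FlipDefs.lean` (`arrW`, the line's `turnSign`, `phase`, `firstPhase`, `inOutSum`,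
`List.count`) is phrased on the LIST `medialExploration E ω` and the polyline winding of its prefixes.
For admissible data the list is the cut orbit `explorationList β c₀ N` of the start corner
(`medialExploration_eq_explorationList`), and everything is read off the orbit: with
`V = {j < N | orb j ∈ {p, partner p}}` the ARRIVAL TIMES at the medial vertex `z = cTgt p` (a vertex
without endpoint on the arc `B`, so that it is neither `e_a` nor `e_b`),

* `arrW γ δ (j+1) = (π/2) · turnCount j` (`arrW_explorationList_succ`), and the line's turn sign at the
  visit `j + 1` is the lattice turn sign `turnSign β (orb j)` (`turnSign_explorationList_succ`);
* `passageSum γ δ (1/3) z = ∑_{j ∈ V} phase ((π/2) turnCount j + (π/4) turnSign (orb j))`;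
* `z ∈ γ ↔ V ≠ ∅`, `γ.idxOf z = min V + 1`, `γ.count z = #V`;
* `inOutSum γ δ z = ∑_{j ∈ V} (phase ((π/2) turnCount j) − phase ((π/2) (turnCount j + turnSign (orb j))))`.

(registered sub-goal `visit_dictionary`). Pure bookkeeping over `winding_orbitPts`, `take_orbitPts`
(`ExplorationWinding.lean`) and the bridge `Polyline.winding = winding` (`MedialWindingBridge.lean`).
-/

noncomputable section

namespace Summit.CriticalPhenomena.CardyFormulaZ2.Cruxes.ParafermionToSLESixFamilies.FlipInvolutionReturnLaw

open MeasureTheory Filter Set Metric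
open scoped BigOperators
open Literature.Probability Literature.Probability.LatticeModels Literature.Probability.Percolation

/-! ## Generic lemmas on `(List.range n).map f` -/

section MapRange

variable {α : Type*} (f : ℕ → α)

/-- Entries of a mapped range. -/
theorem getElem?_map_range (n k : ℕ) :
    ((List.range n).map f)[k]? = if k < n then some (f k) else none := by
  split_ifs with h
  · rw [List.getElem?_map, List.getElem?_range h]; rfl
  · rw [List.getElem?_eq_none]; simpa using Nat.le_of_not_lt h

/-- Membership in a mapped range. -/
theorem mem_map_range_iff (n : ℕ) (z : α) : z ∈ (List.range n).map f ↔ ∃ i < n, f i = z := by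
  simp [List.mem_map, List.mem_range]

/-- The count of `z` in a mapped range is the number of indices hitting `z`. -/
theorem count_map_range [DecidableEq α] (n : ℕ) (z : α) :
    ((List.range n).map f).count z = ((Finset.range n).filter (fun i => f i = z)).card := by
  induction n with
  | zero => simp
  | succ n ih =>
    rw [List.range_succ, List.map_append, List.count_append, ih, List.map_singleton, List.count_singleton',
      Finset.range_add_one, Finset.filter_insert]
    split_ifs with h
    · rw [Finset.card_insert_of_notMem (by simp)]
    · rw [add_zero]

/-- The first index of `z` in a mapped range. -/
theorem idxOf_map_range [DecidableEq α] {n k : ℕ} {z : α} (hk : k < n) (hfk : f k = z)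
    (hmin : ∀ j < k, f j ≠ z) : ((List.range n).map f).idxOf z = k := by
  have hlen : k < ((List.range n).map f).length := by simpa using hk
  rw [List.idxOf, List.findIdx_eq hlen]
  refine ⟨by simpa using hfk, fun j hj => ?_⟩
  have : ((List.range n).map f)[j]'(lt_trans hj hlen) = f j := by simp
  simpa [this] using hmin j hj

end MapRange

/-! ## Winding of the cut orbit: `arrW` and the line's turn sign -/

section Orbit

variable {β : BondConfig (Site 2)} {c₀ : Site 2 × Fin 4}

/-- **Arrival winding along the cut orbit**: for `k ≤ N`, the winding of the polyline prefix
`p₀ … p_k` of `explorationList β c₀ N` is `(π/2) · ∑_{i < k-1} turnSign (orb i)`. -/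
theorem arrW_explorationList {δ : ℝ} (hδ : δ ≠ 0) {k N : ℕ} (hk : k ≤ N) :
    arrW (explorationList β c₀ N) δ k =
      Real.pi / 2 * ∑ i ∈ Finset.range (k - 1), (LatticeModels.turnSign β (cornerOrbit β c₀ i) : ℝ) := by
  rw [arrW, Polyline.winding_eq_winding, map_medialPoint_explorationList, take_orbitPts δ c₀ hk,
    winding_orbitPts hδ, sum_turnOf_eq]

/-- The arrival winding at the visit `j + 1 ≤ N` is `(π/2) · turnCount j`. -/
theorem arrW_explorationList_succ {δ : ℝ} (hδ : δ ≠ 0) {j N : ℕ} (hj : j + 1 ≤ N) :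
    arrW (explorationList β c₀ N) δ (j + 1) = Real.pi / 2 * (turnCount β c₀ j : ℝ) := by
  rw [arrW_explorationList hδ hj, Nat.add_sub_cancel, turnCount]
  push_cast
  rfl

/-- **The line's turn sign is the lattice turn sign**: at the visit `j + 1 < N` the polyline turns by
`(π/2) · turnSign (orb j)`. -/
theorem turnSign_explorationList_succ {δ : ℝ} (hδ : δ ≠ 0) {j N : ℕ} (hj : j + 1 < N) :
    FlipInvolutionReturnLaw.turnSign (explorationList β c₀ N) δ (j + 1) =
      (LatticeModels.turnSign β (cornerOrbit β c₀ j) : ℝ) := by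
  rw [FlipInvolutionReturnLaw.turnSign, show j + 1 + 1 = (j + 1) + 1 from rfl,
    arrW_explorationList_succ hδ (Nat.succ_le_of_lt hj), arrW_explorationList_succ hδ hj.le, turnCount_succ]
  push_cast
  field_simp
  ring

/-- The winding at a passage (average of arrival and departure) at the visit `j + 1 < N`:
`windingAt = (π/2) turnCount j + (π/4) turnSign (orb j)`. -/
theorem windingAt_explorationList_succ {δ : ℝ} (hδ : δ ≠ 0) {j N : ℕ} (hj : j + 1 < N) :
    MedialPath.windingAt (explorationList β c₀ N) δ (j + 1) =
      Real.pi / 2 * (turnCount β c₀ j : ℝ) + Real.pi / 4 * (LatticeModels.turnSign β (cornerOrbit β c₀ j) : ℝ) := by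
  have h1 := arrW_explorationList_succ (β := β) (c₀ := c₀) hδ hj.le
  have h2 := arrW_explorationList_succ (β := β) (c₀ := c₀) hδ (Nat.succ_le_of_lt hj)
  rw [arrW] at h1 h2
  rw [MedialPath.windingAt, h1, show j + 1 + 2 = (j + 1) + 1 + 1 from rfl, h2, turnCount_succ]
  push_cast
  ring

end Orbit

/-! ## The phase -/

/-- The line's `phase` is multiplicative: `phase a * phase b = phase (a + b)` (product form). -/
theorem phase_mul (a b : ℝ) : phase a * phase b = phase (a + b) := by
  rw [phase, phase, phase, ← Complex.exp_add]
  congr 1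
  push_cast
  ring

/-- `‖phase W‖ = 1`. -/
theorem norm_phase (W : ℝ) : ‖phase W‖ = 1 := by
  rw [phase, Complex.norm_exp]
  simp

/-! ## The dictionary at a medial vertex off the arc `B` -/

section Dictionary

variable {E : DiscreteDobrushin} (hE : E.IsZdAdmissible) (ω : BondConfig (Site 2)) {p : Site 2 × Fin 4}

/-- **Positions of a medial vertex off the arc `B` on the exploration path are the arrivals of its two
corners**: for `z = cTgt p` with no endpoint on `B`, position `k` of the cut orbit carries `z` iff
`k = j + 1` with `j < N` and `orb j ∈ {p, partner p}`; moreover then `j + 1 < N`. -/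
theorem position_iff (hB : ∀ x ∈ cTgt p, x ∉ E.zdArcB) (k : ℕ) :
    (explorationList (E.bcBondConfig ω) (DiscreteDobrushin.startCorner hE) (DiscreteDobrushin.exitTime hE ω))[k]? =
        some (cTgt p) ↔
      ∃ j, k = j + 1 ∧ j + 1 < DiscreteDobrushin.exitTime hE ω ∧
        (cornerOrbit (E.bcBondConfig ω) (DiscreteDobrushin.startCorner hE) j = p ∨
          cornerOrbit (E.bcBondConfig ω) (DiscreteDobrushin.startCorner hE) j = cornerPartner p) := by
  set β := E.bcBondConfig ω
  set c₀ := DiscreteDobrushin.startCorner hE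
  set N := DiscreteDobrushin.exitTime hE ω
  have hc₀ := DiscreteDobrushin.isStartCorner_startCorner hE
  have hN := DiscreteDobrushin.not_isInnerFace_exitTime hE ω
  have hlt : ∀ k < N, E.IsInnerFace (cFace (cornerOrbit β c₀ k)) := fun k hk =>
    DiscreteDobrushin.isInnerFace_of_lt_exitTime hE ω hk
  -- position 0 (source `e_a`) and position `N` (source `e_b`) are not passages through `z`
  have h0 : cSrc (cornerOrbit β c₀ 0) ≠ cTgt p := fun h => by
    rw [cornerOrbit_zero] at h
    exact hB _ (h ▸ Sym2.mem_mk_right _ _) hc₀.mem_zdArcB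
  have hlast : ∀ j, j + 1 = N → cTgt (cornerOrbit β c₀ j) ≠ cTgt p := by
    intro j hj h
    obtain ⟨-, -, hBe, -⟩ := cornerOrbit_exit hE hc₀ (n := j) (hlt j (by omega)) (by rw [hj]; exact hN)
    exact hB _ (h ▸ Sym2.mem_mk_right _ _) hBe
  rw [explorationList, getElem?_map_range]
  constructor
  · intro h
    split_ifs at h with hk
    · rw [Option.some.injEq] at h
      obtain ⟨j, rfl⟩ : ∃ j, k = j + 1 := ⟨k - 1, by
        rcases k with _ | k
        · exact absurd h h0
        · simp⟩
      rw [show cSrc (cornerOrbit β c₀ (j + 1)) = cTgt (cornerOrbit β c₀ j) from cSrc_nextCorner _] at h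
      refine ⟨j, rfl, ?_, cTgt_eq_cTgt_iff.1 h⟩
      rcases Nat.lt_or_ge (j + 1) N with h' | h'
      · exact h'
      · exact absurd h (hlast j (by omega))
  · rintro ⟨j, rfl, hj, hjp⟩
    rw [if_pos (by omega), show cSrc (cornerOrbit β c₀ (j + 1)) = cTgt (cornerOrbit β c₀ j) from cSrc_nextCorner _, cTgt_eq_cTgt_iff.2 hjp]

/-- **The visit dictionary** (registered sub-goal `visit_dictionary` of stmt-CriticalPhenomena-11389, line
`flip-involution-return-law`). Admissible data, a configuration `ω`, a corner `p` whose target edge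
`z = cTgt p` has no endpoint on the arc `B`; `γ` the exploration path, `β` the completed configuration,
`c₀` the start corner, `N` the exit time, `V = {j < N | orb j = p ∨ orb j = partner p}` the arrival
times at `z`. Then: (a) the spin-`1/3` passage sum of `γ` at `z` is `∑_{j ∈ V} phase ((π/2) turnCount j
+ (π/4) turnSign (orb j))`; (b) `γ.count z = #V`; (c) the in-minus-out sum is
`∑_{j ∈ V} (phase ((π/2) turnCount j) − phase ((π/2)(turnCount j + turnSign (orb j))))`; (d) if `V` is
empty, `firstPhase γ δ z = 0`; (e) if `i ∈ V` is its least element, `firstPhase γ δ z =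
phase ((π/2) turnCount i)` and the line's turn sign at the first visit `γ.idxOf z = i + 1` is
`turnSign (orb i)`. -/
theorem visit_dictionary : ∀ (E : DiscreteDobrushin) (hE : E.IsZdAdmissible) (ω : BondConfig (Site 2)) (p : Site 2 × Fin 4), (∀ x ∈ cTgt p, x ∉ E.zdArcB) → (MedialPath.passageSum (medialExploration E ω) E.δ (1 / 3) (cTgt p) = ∑ j ∈ (Finset.range (DiscreteDobrushin.exitTime hE ω)).filter (fun j => cornerOrbit (E.bcBondConfig ω) (DiscreteDobrushin.startCorner hE) j = p ∨ cornerOrbit (E.bcBondConfig ω) (DiscreteDobrushin.startCorner hE) j = cornerPartner p), phase (Real.pi / 2 * (turnCount (E.bcBondConfig ω) (DiscreteDobrushin.startCorner hE) j : ℝ) + Real.pi / 4 * (LatticeModels.turnSign (E.bcBondConfig ω) (cornerOrbit (E.bcBondConfig ω) (DiscreteDobrushin.startCorner hE) j) : ℝ))) ∧ ((medialExploration E ω).count (cTgt p) = ((Finset.range (DiscreteDobrushin.exitTime hE ω)).filter (fun j => cornerOrbit (E.bcBondConfig ω) (DiscreteDobrushin.startCorner hE) j = p ∨ cornerOrbit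 (E.bcBondConfig ω) (DiscreteDobrushin.startCorner hE) j = cornerPartner p)).card) ∧ (inOutSum (medialExploration E ω) E.δ (cTgt p) = ∑ j ∈ (Finset.range (DiscreteDobrushin.exitTime hE ω)).filter (fun j => cornerOrbit (E.bcBondConfig ω) (DiscreteDobrushin.startCorner hE) j = p ∨ cornerOrbit (E.bcBondConfig ω) (DiscreteDobrushin.startCorner hE) j = cornerPartner p), (phase (Real.pi / 2 * (turnCount (E.bcBondConfig ω) (DiscreteDobrushin.startCorner hE) j : ℝ)) - phase (Real.pi / 2 * ((turnCount (E.bcBondConfig ω) (DiscreteDobrushin.startCorner hE) j + LatticeModels.turnSign (E.bcBondConfig ω) (cornerOrbit (E.bcBondConfig ω) (DiscreteDobrushin.startCorner hE) j) : ℤ) : ℝ)))) ∧ (((Finset.range (DiscreteDobrushin.exitTime hE ω)).filter (fun j => cornerOrbit (E.bcBondConfig ω) (DiscreteDobrushin.startCorner hE) j = p ∨ cornerOrbit (E.bcBondConfig ω) (DiscreteDobrushin.startCorner hE) j = cornerPartner p)) = ∅ → firstPhase (medialExploration E ω) E.δ (cTgt p) = 0) ∧ (∀ i, i ∈ (Finset.range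 (DiscreteDobrushin.exitTime hE ω)).filter (fun j => cornerOrbit (E.bcBondConfig ω) (DiscreteDobrushin.startCorner hE) j = p ∨ cornerOrbit (E.bcBondConfig ω) (DiscreteDobrushin.startCorner hE) j = cornerPartner p) → (∀ i', i' ∈ (Finset.range (DiscreteDobrushin.exitTime hE ω)).filter (fun j => cornerOrbit (E.bcBondConfig ω) (DiscreteDobrushin.startCorner hE) j = p ∨ cornerOrbit (E.bcBondConfig ω) (DiscreteDobrushin.startCorner hE) j = cornerPartner p) → i ≤ i') → firstPhase (medialExploration E ω) E.δ (cTgt p) = phase (Real.pi / 2 * (turnCount (E.bcBondConfig ω) (DiscreteDobrushin.startCorner hE) i : ℝ)) ∧ (medialExploration E ω).idxOf (cTgt p) = i + 1 ∧ FlipInvolutionReturnLaw.turnSign (medialExploration E ω) E.δ (i + 1) = (LatticeModels.turnSign (E.bcBondConfig ω) (cornerOrbit (E.bcBondConfig ω) (DiscreteDobrushin.startCorner hE) i) : ℝ)) := by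
  intro E hE ω p hB
  classical
  have hδ : E.δ ≠ 0 := hE.delta_pos.ne'
  set β := E.bcBondConfig ω with hβ
  set c₀ := DiscreteDobrushin.startCorner hE with hc₀def
  set N := DiscreteDobrushin.exitTime hE ω with hNdef
  set V := (Finset.range N).filter (fun j => cornerOrbit β c₀ j = p ∨ cornerOrbit β c₀ j = cornerPartner p) with hV
  have hpos := position_iff hE ω hB
  rw [DiscreteDobrushin.medialExploration_eq_explorationList hE ω]
  have hVlt : ∀ j ∈ V, j + 1 < N := by
    intro j hj
    rw [hV, Finset.mem_filter, Finset.mem_range] at hj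
    -- the entry at position `j + 1` is `z`; positions of `z` are `< N` (`z ≠ e_b`)
    have hget : (explorationList β c₀ N)[j + 1]? = some (cTgt p) := by
      rw [explorationList, getElem?_map_range, if_pos (by omega), show cSrc (cornerOrbit β c₀ (j + 1)) = cTgt (cornerOrbit β c₀ j) from cSrc_nextCorner _, cTgt_eq_cTgt_iff.2 hj.2]
    obtain ⟨j', hjj', hj'N, -⟩ := (hpos (j + 1)).1 hget
    omega
  -- the passage positions as the image of `V` under `j ↦ j + 1`
  have hfilter : (Finset.range (N + 1)).filter (fun k => (explorationList β c₀ N)[k]? = some (cTgt p)) =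
      V.image (· + 1) := by
    ext k
    simp only [Finset.mem_filter, Finset.mem_range, Finset.mem_image, hV]
    constructor
    · rintro ⟨-, hk⟩
      obtain ⟨j, rfl, hj, hjp⟩ := (hpos k).1 hk
      exact ⟨j, ⟨by omega, hjp⟩, rfl⟩
    · rintro ⟨j, ⟨hjN, hjp⟩, rfl⟩
      have hk := (hpos (j + 1)).2 ⟨j, rfl, hVlt j (by rw [hV]; exact Finset.mem_filter.2 ⟨Finset.mem_range.2 hjN, hjp⟩), hjp⟩
      obtain ⟨j', hjj', hj'N, -⟩ := (hpos (j + 1)).1 hk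
      exact ⟨by omega, hk⟩
  refine ⟨?_, ?_, ?_, ?_, ?_⟩
  · -- (a) passage sum
    rw [MedialPath.passageSum, length_explorationList', hfilter, Finset.sum_image (fun _ _ _ _ h => Nat.succ_injective h)]
    refine Finset.sum_congr rfl fun j hj => ?_
    rw [windingAt_explorationList_succ hδ (hVlt j hj), phase]
    congr 1
    push_cast
    try ring
  · -- (b) count
    rw [explorationList, count_map_range]
    have : (Finset.range (N + 1)).filter (fun i => cSrc (cornerOrbit β c₀ i) = cTgt p) =
        (Finset.range (N + 1)).filter (fun k => (explorationList β c₀ N)[k]? = some (cTgt p)) := by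
      refine Finset.filter_congr fun k hk => ?_
      rw [Finset.mem_range] at hk
      rw [explorationList, getElem?_map_range, if_pos hk, Option.some.injEq]
    rw [this, hfilter, Finset.card_image_of_injective _ (fun _ _ h => Nat.succ_injective h)]
  · -- (c) in-minus-out sum
    rw [inOutSum, length_explorationList', hfilter, Finset.sum_image (fun _ _ _ _ h => Nat.succ_injective h)]
    refine Finset.sum_congr rfl fun j hj => ?_
    have hj1 := hVlt j hj
    rw [arrW_explorationList_succ hδ hj1.le, show j + 1 + 1 = (j + 1) + 1 from rfl,
      arrW_explorationList_succ hδ (Nat.succ_le_of_lt hj1), turnCount_succ]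
  · -- (d) no visit
    intro hVe
    rw [firstPhase, if_neg]
    intro hmem
    obtain ⟨k, hk, hkz⟩ := List.getElem_of_mem hmem
    have hget : (explorationList β c₀ N)[k]? = some (cTgt p) := by rw [List.getElem?_eq_getElem hk, hkz]
    obtain ⟨j, hkj, hj, hjp⟩ := (hpos k).1 hget
    have : j ∈ V := by rw [hV]; exact Finset.mem_filter.2 ⟨Finset.mem_range.2 (by omega), hjp⟩
    rw [hVe] at this
    exact absurd this (Finset.notMem_empty _)
  · -- (e) first visit
    intro i hi hmin
    have hi1 := hVlt i hi
    rw [hV, Finset.mem_filter, Finset.mem_range] at hi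
    have hidx : (explorationList β c₀ N).idxOf (cTgt p) = i + 1 := by
      rw [explorationList]
      refine idxOf_map_range _ (by omega) (by rw [show cSrc (cornerOrbit β c₀ (i + 1)) = cTgt (cornerOrbit β c₀ i) from cSrc_nextCorner _, cTgt_eq_cTgt_iff.2 hi.2]) fun k hk hk' => ?_
      have hget : (explorationList β c₀ N)[k]? = some (cTgt p) := by
        rw [explorationList, getElem?_map_range, if_pos (by omega), hk']
      obtain ⟨j, rfl, hj, hjp⟩ := (hpos k).1 hget
      have := hmin j (by rw [hV]; exact Finset.mem_filter.2 ⟨Finset.mem_range.2 (by omega), hjp⟩)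
      omega
    have hmem : cTgt p ∈ explorationList β c₀ N := by
      rw [explorationList, mem_map_range_iff]
      exact ⟨i + 1, by omega, by rw [show cSrc (cornerOrbit β c₀ (i + 1)) = cTgt (cornerOrbit β c₀ i) from cSrc_nextCorner _, cTgt_eq_cTgt_iff.2 hi.2]⟩
    refine ⟨?_, hidx, turnSign_explorationList_succ hδ hi1⟩
    rw [firstPhase, if_pos hmem, hidx, arrW_explorationList_succ hδ hi1.le]

end Dictionary

end Summit.CriticalPhenomena.CardyFormulaZ2.Cruxes.ParafermionToSLESixFamilies.FlipInvolutionReturnLaw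

end
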